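import Mathlib
import HarnessLib
import Summits.ValiantsHypothesis.ValiantsHypothesis.Theorems.SymmetryDialPairKeyedScheme

/-!
# Symmetry dial — the KEY-TRIPLE IDENTITY (NODE-g11 §2, lens 1, g11)

For a positional square `Q = (p; a, c)` (`x = p + g_c`, `y = p + g_a`, `o = p + g_a + g_c`) and an
edge subset with flags `η₁ … η₄` (edges `(p,x)`, `(p,y)`, `(x,o)`, `(y,o)`), write `A, B, C` for the
slot sums at `x, y, o` (`slotX`, `slotY`, `slotO` of `SymmetryDialPairKeyedScheme`).  The pair-key triple
of the figure is `{A + B, B + C, A + C}` (`pkTriple`): square key, prism-`x` key, prism-`y` key.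

**Identity.**  EVERY element of the triple is, for EVERY `o`-edge of the figure (`(x,o)` if `η₃`,
`(y,o)` if `η₄`), a ONE-dual key of that edge at the pin `p` in the sense of `SymmetryDialKeyedScheme.keyed`
(square / prism-`o` / rung disjunct, with explicit switches computed from the flags) — §2.  Consequently
(§3) every edge of a pair-keyed figure whose corner `p` is PINNED is already protected by the one-dual
keyed scheme `protKey` through whichever element of the triple is pebbled: the star edges by the pin,
the `o`-edges by the identity.  In the certificate language of NODE-g10/g11 this is
`PK(B) ⊆ star(p) ∪ Key(p, β')` for every non-zero `β'` in the triple, i.e. the KEEP set at the latest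
pebble `β` of a class-`(1,2)` configuration `({p}, {β, β'})` contains the pair-keyed rows — the
algebraic half of NODE-g11's CLASS (1,2) THEOREM (the other half is the one-pin rigidity Lemma 3 with
its finite design checks).  No rank computation and no design hypothesis is involved: the identity holds
for every `Design`.

The development is self-contained; it supports `Theses/SymmetryDial.lean` crux `SymHardAffineSupported`
via `AffinePebblePairs` / `affinePebbleEquiv_of_condLinPK` and does not prove the crux: VP ≠ VNP is not
advanced by this file.
-/

set_option linter.dupNamespace false

namespace Summit.ValiantsHypothesis.ValiantsHypothesis.Theorems.SymmetryDialKeyTriple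

open SymmetryDialAffinePebble (V)
open SymmetryDialAffineOrbits (add_self)
open SymmetryDialDisalignedCFI (Design)
open SymmetryDialShearInvariant (Pos)
open SymmetryDialCondScheme (pinned dualPeb)
open SymmetryDialKeyedScheme (sw keyed protKey protKey_of_pinned_left)
open SymmetryDialPairKeyedScheme (slotX slotY slotO pkFlags pkEdge pkTriple)

variable {d₀ r δ : ℕ}

/-! ## §1 Switch algebra -/

/-- The switch `true` keeps its argument. -/
@[simp] theorem sw_true (x : V r) : sw true x = x := by simp [sw]

/-- The switch `false` kills its argument. -/
@[simp] theorem sw_false (x : V r) : sw false x = 0 := by simp [sw]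

/-- Switches are additive. -/
theorem sw_add (ε : Bool) (x y : V r) : sw ε (x + y) = sw ε x + sw ε y := by
  cases ε <;> simp [sw]

/-- `p + g_a + g_c + g_a = p + g_c` (characteristic two). -/
theorem corner_cancel_a (D : Design d₀ r δ) (p : V d₀) (a c : Fin δ) :
    p + D.gen a + D.gen c + D.gen a = p + D.gen c := by
  rw [add_right_comm p (D.gen a) (D.gen c), add_assoc (p + D.gen c), add_self, add_zero]

/-- `p + g_a + g_c + g_c = p + g_a`. -/
theorem corner_cancel_c (D : Design d₀ r δ) (p : V d₀) (a c : Fin δ) :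
    p + D.gen a + D.gen c + D.gen c = p + D.gen a := by
  rw [add_assoc (p + D.gen a), add_self, add_zero]

/-! ## §2 The six keying lemmas (flags symbolic, switches explicit) -/

/-- The SQUARE key `A + B` keys `(x, o)` (square disjunct, labels `(a, c)`, switches `(η₄, η₁, η₂)`). -/
theorem keyed_sq_xo (D : Design d₀ r δ) (p : V d₀) {a c : Fin δ} (hac : a ≠ c) (η₁ η₂ η₄ : Bool) :
    keyed D p (slotX D p a c η₁ true + slotY D p a c η₂ η₄) (p + D.gen c) (p + D.gen a + D.gen c)
      = true := by
  unfold keyed; rw [decide_eq_true_eq]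
  refine ⟨a, c, hac, Or.inl ⟨rfl, by abel, η₄, η₁, η₂, ?_⟩⟩
  simp only [slotX, slotY, sw_true]; abel

/-- The SQUARE key `A + B` keys `(y, o)` (square disjunct, labels `(c, a)`, switches `(η₃, η₂, η₁)`). -/
theorem keyed_sq_yo (D : Design d₀ r δ) (p : V d₀) {a c : Fin δ} (hac : a ≠ c) (η₁ η₂ η₃ : Bool) :
    keyed D p (slotX D p a c η₁ η₃ + slotY D p a c η₂ true) (p + D.gen a) (p + D.gen a + D.gen c)
      = true := by
  unfold keyed; rw [decide_eq_true_eq]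
  refine ⟨c, a, hac.symm, Or.inl ⟨rfl, rfl, η₃, η₂, η₁, ?_⟩⟩
  simp only [slotX, slotY, sw_true]; abel

/-- The PRISM-`x` key `B + C` keys `(x, o)` as `(o, x)` (prism-`o` disjunct, labels `(a, c)`,
switches `(η₄, η₂)`). -/
theorem keyed_px_ox (D : Design d₀ r δ) (p : V d₀) {a c : Fin δ} (hac : a ≠ c) (η₂ η₄ : Bool) :
    keyed D p (slotY D p a c η₂ η₄ + slotO D p a c true η₄) (p + D.gen a + D.gen c) (p + D.gen c)
      = true := by
  unfold keyed; rw [decide_eq_true_eq]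
  refine ⟨a, c, hac, Or.inr (Or.inl ⟨rfl, (corner_cancel_a D p a c).symm, η₄, η₂, ?_⟩)⟩
  simp only [slotY, slotO, sw_true, sw_add]; abel

/-- The PRISM-`x` key `B + C` keys `(y, o)` (rung disjunct, labels `(a, c)`, switches `(η₃, η₂)`). -/
theorem keyed_px_yo (D : Design d₀ r δ) (p : V d₀) {a c : Fin δ} (hac : a ≠ c) (η₂ η₃ : Bool) :
    keyed D p (slotY D p a c η₂ true + slotO D p a c η₃ true) (p + D.gen a) (p + D.gen a + D.gen c)
      = true := by
  unfold keyed; rw [decide_eq_true_eq]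
  refine ⟨a, c, hac, Or.inr (Or.inr ⟨rfl, rfl, η₃, η₂, ?_⟩)⟩
  simp only [slotY, slotO, sw_true]; abel

/-- The PRISM-`y` key `A + C` keys `(x, o)` (rung disjunct, labels `(c, a)`, switches `(η₄, η₁)`). -/
theorem keyed_py_xo (D : Design d₀ r δ) (p : V d₀) {a c : Fin δ} (hac : a ≠ c) (η₁ η₄ : Bool) :
    keyed D p (slotX D p a c η₁ true + slotO D p a c true η₄) (p + D.gen c) (p + D.gen a + D.gen c)
      = true := by
  unfold keyed; rw [decide_eq_true_eq]
  refine ⟨c, a, hac.symm, Or.inr (Or.inr ⟨rfl, by abel, η₄, η₁, ?_⟩)⟩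
  simp only [slotX, slotO, sw_true]; abel

/-- The PRISM-`y` key `A + C` keys `(y, o)` as `(o, y)` (prism-`o` disjunct, labels `(c, a)`,
switches `(η₃, η₁)`). -/
theorem keyed_py_oy (D : Design d₀ r δ) (p : V d₀) {a c : Fin δ} (hac : a ≠ c) (η₁ η₃ : Bool) :
    keyed D p (slotX D p a c η₁ η₃ + slotO D p a c η₃ true) (p + D.gen a + D.gen c) (p + D.gen a)
      = true := by
  unfold keyed; rw [decide_eq_true_eq]
  refine ⟨c, a, hac.symm, Or.inr (Or.inl ⟨by abel, (corner_cancel_c D p a c).symm, η₃, η₁, ?_⟩)⟩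
  simp only [slotX, slotO, sw_true, sw_add]; abel

/-! ## §3 The key-triple identity -/

/-- **Key-triple identity, edge `(x, o)`.**  If the figure contains `(x, o)` (`η₃ = true`), every
element of its key triple keys `(x, o)` at `p` (in one of the two orientations). -/
theorem keyTriple_keys_xo (D : Design d₀ r δ) (p : V d₀) {a c : Fin δ} (hac : a ≠ c)
    (η₁ η₂ η₄ : Bool) (β : V r) (hβ : pkTriple D p a c η₁ η₂ true η₄ β = true) :
    keyed D p β (p + D.gen c) (p + D.gen a + D.gen c) = true ∨
      keyed D p β (p + D.gen a + D.gen c) (p + D.gen c) = true := by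
  unfold pkTriple at hβ; rw [decide_eq_true_eq] at hβ
  rcases hβ with rfl | rfl | rfl
  · exact Or.inl (keyed_sq_xo D p hac η₁ η₂ η₄)
  · exact Or.inr (keyed_px_ox D p hac η₂ η₄)
  · exact Or.inl (keyed_py_xo D p hac η₁ η₄)

/-- **Key-triple identity, edge `(y, o)`.**  If the figure contains `(y, o)` (`η₄ = true`), every
element of its key triple keys `(y, o)` at `p` (in one of the two orientations). -/
theorem keyTriple_keys_yo (D : Design d₀ r δ) (p : V d₀) {a c : Fin δ} (hac : a ≠ c)
    (η₁ η₂ η₃ : Bool) (β : V r) (hβ : pkTriple D p a c η₁ η₂ η₃ true β = true) :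
    keyed D p β (p + D.gen a) (p + D.gen a + D.gen c) = true ∨
      keyed D p β (p + D.gen a + D.gen c) (p + D.gen a) = true := by
  unfold pkTriple at hβ; rw [decide_eq_true_eq] at hβ
  rcases hβ with rfl | rfl | rfl
  · exact Or.inl (keyed_sq_yo D p hac η₁ η₂ η₃)
  · exact Or.inl (keyed_px_yo D p hac η₂ η₃)
  · exact Or.inr (keyed_py_oy D p hac η₁ η₃)

/-! ## §4 Scheme form: pair-keyed rows at a pinned corner are keyed rows -/

/-- A pebbled dual that keys `(v, w)` (either orientation) at a pinned `p` makes `(v, w)` protected by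
the keyed scheme. -/
theorem protKey_of_keyed {k : ℕ} (D : Design d₀ r δ) (s : Pos k (d₀ + r)) (p : V d₀) (β : V r)
    (v w : V d₀) (hp : pinned s p = true) (hβ : dualPeb s β = true)
    (hk : keyed D p β v w = true ∨ keyed D p β w v = true) : protKey k D s v w = true := by
  unfold protKey
  rw [Bool.or_eq_true]
  exact Or.inr (decide_eq_true ⟨p, β, hp, hβ, hk⟩)

/-- **PK ⊆ star ∪ Key at a pinned corner (NODE-g11 §2).**  Let `p` be pinned and `β` a pebbled dual
lying in the key triple of the figure `(Q, p, x)` (`Q = (p; a, c)`, flags `η`).  Then EVERY flagged edge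
of the figure is protected by the one-dual keyed scheme `protKey` (for the `o`-edges in at least one
orientation): the star edges `(p,x)`, `(p,y)` by the pin, the `o`-edges by the key-triple identity.
This is the row inclusion `KEEP(latest β₂) ⊇ PK({β, β₂})` used by the CLASS (1,2) THEOREM. -/
theorem protKey_of_pkEdge_pinned {k : ℕ} (D : Design d₀ r δ) (s : Pos k (d₀ + r)) (p : V d₀)
    (β : V r) {a c : Fin δ} (hac : a ≠ c) (η₁ η₂ η₃ η₄ : Bool) (v w : V d₀)
    (hp : pinned s p = true) (hβ : dualPeb s β = true)
    (he : pkEdge D p a c η₁ η₂ η₃ η₄ v w = true) (ht : pkTriple D p a c η₁ η₂ η₃ η₄ β = true) :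
    protKey k D s v w = true ∨ protKey k D s w v = true := by
  unfold pkEdge at he; rw [decide_eq_true_eq] at he
  rcases he with ⟨-, rfl, rfl⟩ | ⟨-, rfl, rfl⟩ | ⟨h₃, rfl, rfl⟩ | ⟨h₄, rfl, rfl⟩
  · exact Or.inl (protKey_of_pinned_left D s _ _ hp)
  · exact Or.inl (protKey_of_pinned_left D s _ _ hp)
  · subst h₃
    rcases keyTriple_keys_xo D p hac η₁ η₂ η₄ β ht with h | h
    · exact Or.inl (protKey_of_keyed D s p β _ _ hp hβ (Or.inl h))
    · exact Or.inr (protKey_of_keyed D s p β _ _ hp hβ (Or.inl h))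
  · subst h₄
    rcases keyTriple_keys_yo D p hac η₁ η₂ η₃ β ht with h | h
    · exact Or.inl (protKey_of_keyed D s p β _ _ hp hβ (Or.inl h))
    · exact Or.inr (protKey_of_keyed D s p β _ _ hp hβ (Or.inl h))

/-- The admissibility flags play no role in the identity (recorded for the census: `pkFlags` only
restricts WHICH figures carry pair keys, not whether their rows are keyed). -/
theorem protKey_of_pkEdge_pinned' {k : ℕ} (D : Design d₀ r δ) (s : Pos k (d₀ + r)) (p : V d₀)
    (β : V r) {a c : Fin δ} (hac : a ≠ c) (η₁ η₂ η₃ η₄ : Bool) (v w : V d₀)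
    (hp : pinned s p = true) (hβ : dualPeb s β = true) (_hf : pkFlags η₁ η₂ η₃ η₄ = true)
    (he : pkEdge D p a c η₁ η₂ η₃ η₄ v w = true) (ht : pkTriple D p a c η₁ η₂ η₃ η₄ β = true) :
    protKey k D s v w = true ∨ protKey k D s w v = true :=
  protKey_of_pkEdge_pinned D s p β hac η₁ η₂ η₃ η₄ v w hp hβ he ht

end Summit.ValiantsHypothesis.ValiantsHypothesis.Theorems.SymmetryDialKeyTriple
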